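import Summits.ResolutionOfSingularities.ResolutionOfSingularities.Theorems.ValuativeLuAlphaPTorsorAdaptedValueStepClaimC
import HarnessLib

/-!
# Adapted value step, VIII: the level recursion (type-2 cure of the hidden torsion)

Crux `Valuative.LuAlphaPTorsor` (stmt-ResolutionOfSingularities-0641), line `pfaff-line-log-final-forms`,
registered stub `stub_adaptedValueStep` (F6v, wave 2: the ADAPTED value step of the purely
inseparable tower, any rank) — helper file 8/8.

`adValue_recursion`: from the saturation property of `R₁ = R[y]` at every level, type-2
exponents `D` (`D j` supported on the levels `< lv' j`) are built level by level — at level `ℓ`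
the finitely many generators of the ideal of small elements of `R₁[y_j / y^(D j) : lv' j < ℓ]`
(Hilbert) are put into the ideal generated by the `y_h / y^(D h)`, `lv' h ≥ ℓ`, by enlarging the
`D h` — so that in `R₃ = R₁[y_j / y^(D j) : all j]` the small elements of every level are
generated by the high transformed parameters (`adValue_split` separates the high part of an
element of `R₃`). [folklore]
-/

noncomputable section

-- `Summit.<S>.<S>.…` duplicates the summit name by design (D-0017, single-problem summit).
set_option linter.dupNamespace false

open IsLocalRing

namespace Summit.ResolutionOfSingularities.ResolutionOfSingularities.Theorems.PfaffLine

open Literature.AlgebraicGeometry.Resolution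

section Recursion

variable {k K : Type} [Field k] [Field K] [Algebra k K] (O : ValuationSubring K) {n : ℕ}

variable (R₁ : Subalgebra k K) (y : Fin n → K) (lv' : Fin n → ℕ) (hy0 : ∀ j, y j ≠ 0)
  (hyR₁ : ∀ j, y j ∈ R₁)

include hy0 in
/-- Quotients of monomials with exponents in `ℕ`. -/
theorem adValue_prod_pow_div (a b : Fin n → ℕ) (hab : ∀ i, b i ≤ a i) :
    (∏ i, y i ^ (a i)) * (∏ i, y i ^ (b i))⁻¹ = ∏ i, y i ^ (a i - b i) := by
  rw [← Finset.prod_inv_distrib, ← Finset.prod_mul_distrib]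
  exact Finset.prod_congr rfl fun i _ => (pow_sub₀ _ (hy0 i) (hab i)).symm

/-- The value of a type-2 transformed parameter. -/
theorem adValue_t2_val (D : Fin n → Fin n → ℕ) (j : Fin n) :
    O.valuation (y j * (∏ i, y i ^ (D j i))⁻¹) =
      O.valuation (y j) * (∏ i, O.valuation (y i) ^ (D j i))⁻¹ := by
  rw [map_mul, map_inv₀, valuation_prod_pow]

include hy0 in
/-- Type-2 transformed parameters have value `< 1` (hence lie in `O`). -/
theorem adValue_t2_val_lt_one (hvy1 : ∀ j, O.valuation (y j) < 1)
    (hC2a' : ∀ i i', lv' i < lv' i' → ∀ m : Fin n → ℤ, (∀ j, lv' i < lv' j → m j = 0) →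
      O.valuation (y i') < ∏ j, O.valuation (y j) ^ (m j))
    (D : Fin n → Fin n → ℕ) (hD : ∀ j i, lv' j ≤ lv' i → D j i = 0) (j : Fin n) :
    O.valuation (y j * (∏ i, y i ^ (D j i))⁻¹) < 1 := by
  rw [adValue_t2_val]
  exact adValue_t2_lt_one (fun j => O.valuation (y j)) lv' D
    (fun j => (map_ne_zero _).mpr (hy0 j)) hC2a' hvy1 hD j

include hy0 in
/-- **Old parameters are `ℕ`-monomials in the type-2 transformed ones**: with `D j` supported on
the levels `< lv' j`, every `y j` is a monomial with exponents in `ℕ` in the `y i / y^(D i)`. -/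
theorem adValue_t2_elem_repr (D : Fin n → Fin n → ℕ) (hD : ∀ j i, lv' j ≤ lv' i → D j i = 0) :
    ∀ j, ∃ E : Fin n → ℕ, y j = ∏ i, (y i * (∏ l, y l ^ (D i l))⁻¹) ^ (E i) := by
  classical
  have hP0 : ∀ e : Fin n → ℕ, (∏ i, y i ^ (e i)) ≠ 0 := fun e =>
    Finset.prod_ne_zero_iff.mpr fun i _ => pow_ne_zero _ (hy0 i)
  -- by strong induction on the level
  suffices h : ∀ (b : ℕ) (j : Fin n), lv' j < b →
      ∃ E : Fin n → ℕ, y j = ∏ i, (y i * (∏ l, y l ^ (D i l))⁻¹) ^ (E i) from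
    fun j => h (lv' j + 1) j (Nat.lt_succ_self _)
  intro b
  induction b with
  | zero => exact fun j hj => absurd hj (Nat.not_lt_zero _)
  | succ b ih =>
    intro j hj
    -- the lower parameters occurring in `y^(D j)` are monomials in the new ones
    have hE : ∀ i, ∃ E : Fin n → ℕ, D j i ≠ 0 →
        y i = ∏ l, (y l * (∏ l', y l' ^ (D l l'))⁻¹) ^ (E l) := by
      intro i
      by_cases hi : D j i = 0
      · exact ⟨0, fun h => (h hi).elim⟩
      · have hlt : lv' i < lv' j := by
          by_contra h
          exact hi (hD j i (not_lt.mp h))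
        obtain ⟨E, hEi⟩ := ih i (by omega)
        exact ⟨E, fun _ => hEi⟩
    choose E hE using hE
    refine ⟨fun l => (if l = j then 1 else 0) + ∑ i, D j i * E i l, ?_⟩
    have hyj : y j = (y j * (∏ l, y l ^ (D j l))⁻¹) * ∏ i, y i ^ (D j i) := by
      rw [inv_mul_cancel_right₀ (hP0 _)]
    have hprod : (∏ i, y i ^ (D j i)) =
        ∏ l, (y l * (∏ l', y l' ^ (D l l'))⁻¹) ^ (∑ i, D j i * E i l) := by
      have h1 : ∀ i, y i ^ (D j i) =
          ∏ l, (y l * (∏ l', y l' ^ (D l l'))⁻¹) ^ (D j i * E i l) := by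
        intro i
        by_cases hi : D j i = 0
        · simp [hi]
        · conv_lhs => rw [hE i hi]
          rw [← Finset.prod_pow]
          exact Finset.prod_congr rfl fun l _ => by rw [← pow_mul, Nat.mul_comm]
      rw [Finset.prod_congr rfl (fun i _ => h1 i), Finset.prod_comm]
      exact Finset.prod_congr rfl fun l _ => Finset.prod_pow_eq_pow_sum _ _ _
    have key : ∀ (f : Fin n → K) (S : Fin n → ℕ),
        (∏ l, f l ^ ((if l = j then 1 else 0) + S l)) = f j * ∏ l, f l ^ (S l) := by
      intro f S
      rw [Finset.prod_congr rfl (fun l _ => pow_add (f l) _ (S l)), Finset.prod_mul_distrib]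
      simp only [pow_boole, Finset.prod_ite_eq', Finset.mem_univ, if_true]
    beta_reduce
    rw [key]
    conv_lhs => rw [hyj]
    nth_rewrite 2 [hprod]
    rfl

include hy0 hyR₁ in
/-- **The level recursion.** Given the saturation property of `R₁ = R[y]` at every level, there
are type-2 exponents `D` (each `D j` supported on the levels `< lv' j`) such that, for every
level `ℓ < L₀`, every small element of `R₁[y_j / y^{D j} : lv' j < ℓ]` lies in the ideal of
`R₁[y_j / y^{D j} : all j]` generated by the `y_h / y^{D h}`, `lv' h ≥ ℓ`. -/
theorem adValue_recursion (hR₁O : R₁.toSubring ≤ O.toSubring) (hR₁fg : R₁.FG)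
    (hvy1 : ∀ j, O.valuation (y j) < 1)
    (hC2a' : ∀ i i', lv' i < lv' i' → ∀ m : Fin n → ℤ, (∀ j, lv' i < lv' j → m j = 0) →
      O.valuation (y i') < ∏ j, O.valuation (y j) ^ (m j))
    (hsat : ∀ (ℓ : ℕ) (z : K), z ∈ R₁ →
      (∀ m : Fin n → ℤ, (∀ j, ℓ ≤ lv' j → m j = 0) →
        O.valuation z < ∏ j, O.valuation (y j) ^ (m j)) →
      ∃ g : Fin n → ℕ, (∀ j, ℓ ≤ lv' j → g j = 0) ∧ ∃ b : Fin n → K, (∀ h, b h ∈ R₁) ∧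
        (∏ j, y j ^ (g j)) * z = ∑ h ∈ Finset.univ.filter (fun h => ℓ ≤ lv' h), y h * b h) :
    ∀ L₀ : ℕ, ∃ D : Fin n → Fin n → ℕ, (∀ j i, lv' j ≤ lv' i → D j i = 0) ∧
      ∀ ℓ, ℓ < L₀ → ∀ z ∈ Algebra.adjoin k ((R₁ : Set K) ∪
        ((fun j => y j * (∏ i, y i ^ (D j i))⁻¹) '' {j | lv' j < ℓ})),
        (∀ m : Fin n → ℤ, (∀ j, ℓ ≤ lv' j → m j = 0) →
          O.valuation z < ∏ j, O.valuation (y j) ^ (m j)) →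
        ∃ b : Fin n → K, (∀ h, b h ∈ Algebra.adjoin k ((R₁ : Set K) ∪
          Set.range (fun j => y j * (∏ i, y i ^ (D j i))⁻¹))) ∧
          z = ∑ h ∈ Finset.univ.filter (fun h => ℓ ≤ lv' h),
            (y h * (∏ i, y i ^ (D h i))⁻¹) * b h := by
  classical
  have hP0 : ∀ e : Fin n → ℕ, (∏ i, y i ^ (e i)) ≠ 0 := fun e =>
    Finset.prod_ne_zero_iff.mpr fun i _ => pow_ne_zero _ (hy0 i)
  intro L₀
  induction L₀ with
  | zero => exact ⟨fun _ _ => 0, fun _ _ _ => rfl, fun ℓ hℓ => absurd hℓ (Nat.not_lt_zero _)⟩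
  | succ L₀ ih =>
    obtain ⟨D, hD, hgood⟩ := ih
    -- the ring `A = R₁[y_j / y^{D j} : lv' j < L₀]`
    set A : Subalgebra k K := Algebra.adjoin k ((R₁ : Set K) ∪
      ((fun j => y j * (∏ i, y i ^ (D j i))⁻¹) '' {j | lv' j < L₀})) with hA
    have hyDO : ∀ j, y j * (∏ i, y i ^ (D j i))⁻¹ ∈ O := fun j =>
      (O.valuation_le_one_iff _).mp (adValue_t2_val_lt_one O y lv' hy0 hvy1 hC2a' D hD j).le
    have hAO : A.toSubring ≤ O.toSubring := by
      let OK : Subalgebra k K :=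
        { O.toSubring with algebraMap_mem' := fun c => hR₁O (R₁.algebraMap_mem c) }
      change A ≤ OK
      refine Algebra.adjoin_le ?_
      rintro z (hz | ⟨j, -, rfl⟩)
      exacts [hR₁O hz, hyDO j]
    have hAfg : A.FG := by
      obtain ⟨S₀, hS₀⟩ := hR₁fg
      have hfin : (((fun j => y j * (∏ i, y i ^ (D j i))⁻¹) '' {j | lv' j < L₀})).Finite :=
        (Set.toFinite _).image _
      refine Subalgebra.fg_def.mpr ⟨↑S₀ ∪ _, S₀.finite_toSet.union hfin, ?_⟩
      rw [hA, Algebra.adjoin_union, Algebra.adjoin_union, hS₀, Algebra.adjoin_eq]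
    obtain ⟨s, hs, hinds⟩ := adValue_small_generators O y lv' hy0 A hAO hAfg L₀
    -- exponents for the generators
    have hgen : ∀ g : K, ∃ (F : Fin n → ℕ) (b : Fin n → K), g ∈ s →
        (∀ j, L₀ ≤ lv' j → F j = 0) ∧ (∀ h, b h ∈ R₁) ∧
        (∏ j, y j ^ (F j)) * g = ∑ h ∈ Finset.univ.filter (fun h => L₀ ≤ lv' h), y h * b h := by
      intro g
      by_cases hg : g ∈ s
      · obtain ⟨hgA, hgsmall⟩ := hs g hg
        obtain ⟨e, he, hegR⟩ := adValue_normal_form R₁ y lv' hy0 hyR₁ D hD L₀ hgA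
        obtain ⟨f, hf, b, hb, hfb⟩ := hsat L₀ _ hegR (fun m hm => by
          rw [mul_comm]
          exact adValue_small_mul O y lv' ((O.valuation_le_one_iff _).mpr
            (hR₁O (R₁.prod_mem fun j _ => R₁.pow_mem (hyR₁ j) _))) L₀ hgsmall m hm)
        refine ⟨f + e, b, fun _ => ⟨fun j hj => by rw [Pi.add_apply, hf j hj, he j hj], hb, ?_⟩⟩
        rw [← hfb, ← mul_assoc, ← Finset.prod_mul_distrib]
        exact congrArg (· * g) (Finset.prod_congr rfl fun j _ => pow_add _ _ _)
      · exact ⟨0, 0, fun h => (hg h).elim⟩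
    choose Ff bf hgen using hgen
    set e : Fin n → ℕ := fun i => ∑ g ∈ s, Ff g i with he
    have hesupp : ∀ j, L₀ ≤ lv' j → e j = 0 := fun j hj =>
      Finset.sum_eq_zero fun g hg => (hgen g hg).1 j hj
    have hFe : ∀ g ∈ s, ∀ i, Ff g i ≤ e i := fun g hg i =>
      Finset.single_le_sum (f := fun g => Ff g i) (fun _ _ => Nat.zero_le _) hg
    -- the new exponents
    set D' : Fin n → Fin n → ℕ := fun j i => if L₀ ≤ lv' j then D j i + e i else D j i with hD'
    have hD'supp : ∀ j i, lv' j ≤ lv' i → D' j i = 0 := by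
      intro j i hji
      by_cases hj : L₀ ≤ lv' j
      · simp only [hD', if_pos hj, hD j i hji, hesupp i (hj.trans hji)]
      · simp only [hD', if_neg hj, hD j i hji]
    have hDD' : ∀ j i, D j i ≤ D' j i := fun j i => by
      by_cases hj : L₀ ≤ lv' j <;> simp [hD', hj]
    have hD'low : ∀ j, lv' j < L₀ → D' j = D j := fun j hj => by
      funext i; simp [hD', not_le.mpr hj]
    -- old transformed parameters in terms of the new ones
    have hrel : ∀ j, y j * (∏ i, y i ^ (D j i))⁻¹ =
        (y j * (∏ i, y i ^ (D' j i))⁻¹) * ∏ i, y i ^ (D' j i - D j i) := fun j => by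
      rw [← adValue_prod_pow_div y hy0 _ _ (hDD' j), mul_assoc, inv_mul_cancel_left₀ (hP0 _)]
    set R3' : Subalgebra k K := Algebra.adjoin k ((R₁ : Set K) ∪
      Set.range (fun j => y j * (∏ i, y i ^ (D' j i))⁻¹)) with hR3'
    have hR₁R3' : R₁ ≤ R3' := fun z hz => Algebra.subset_adjoin (Or.inl hz)
    have hyD'R3' : ∀ j, y j * (∏ i, y i ^ (D' j i))⁻¹ ∈ R3' := fun j =>
      Algebra.subset_adjoin (Or.inr ⟨j, rfl⟩)
    have hyDR3' : ∀ j, y j * (∏ i, y i ^ (D j i))⁻¹ ∈ R3' := fun j => by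
      rw [hrel j]
      exact R3'.mul_mem (hyD'R3' j) (hR₁R3' (R₁.prod_mem fun i _ => R₁.pow_mem (hyR₁ i) _))
    have hR3R3' : Algebra.adjoin k ((R₁ : Set K) ∪
        Set.range (fun j => y j * (∏ i, y i ^ (D j i))⁻¹)) ≤ R3' := by
      refine Algebra.adjoin_le ?_
      rintro z (hz | ⟨j, rfl⟩)
      exacts [hR₁R3' hz, hyDR3' j]
    have hAR3' : A ≤ R3' := by
      refine Algebra.adjoin_le ?_
      rintro z (hz | ⟨j, -, rfl⟩)
      exacts [hR₁R3' hz, hyDR3' j]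
    -- the rings below a level `ℓ ≤ L₀` do not change
    have hAeq : ∀ ℓ, ℓ ≤ L₀ → Algebra.adjoin k ((R₁ : Set K) ∪
        ((fun j => y j * (∏ i, y i ^ (D' j i))⁻¹) '' {j | lv' j < ℓ})) =
        Algebra.adjoin k ((R₁ : Set K) ∪
          ((fun j => y j * (∏ i, y i ^ (D j i))⁻¹) '' {j | lv' j < ℓ})) := by
      intro ℓ hℓ
      congr 2
      refine Set.image_congr fun j hj => ?_
      rw [hD'low j (lt_of_lt_of_le hj hℓ)]
    refine ⟨D', hD'supp, fun ℓ hℓ z hz hsmall => ?_⟩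
    rcases (Nat.lt_succ_iff.mp hℓ).lt_or_eq with hlt | heq
    · -- levels `< L₀`: monotonicity
      rw [hAeq ℓ hlt.le] at hz
      obtain ⟨b, hb, hzb⟩ := hgood ℓ hlt z hz hsmall
      refine ⟨fun h => (∏ i, y i ^ (D' h i - D h i)) * b h, fun h => R3'.mul_mem
        (hR₁R3' (R₁.prod_mem fun i _ => R₁.pow_mem (hyR₁ i) _)) (hR3R3' (hb h)), ?_⟩
      rw [hzb]
      exact Finset.sum_congr rfl fun h _ => by rw [hrel h, mul_assoc]
    · -- the level `L₀` itself: the generators of the small ideal of `A`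
      subst heq
      rw [hAeq ℓ le_rfl] at hz
      refine hinds (fun z => ∃ b : Fin n → K, (∀ h, b h ∈ R3') ∧
          z = ∑ h ∈ Finset.univ.filter (fun h => ℓ ≤ lv' h),
            (y h * (∏ i, y i ^ (D' h i))⁻¹) * b h) ?_ ?_ ?_ ?_ z hz hsmall
      · exact ⟨0, fun _ => R3'.zero_mem, by simp⟩
      · rintro a₁ a₂ ⟨b₁, hb₁, rfl⟩ ⟨b₂, hb₂, rfl⟩
        refine ⟨b₁ + b₂, fun h => R3'.add_mem (hb₁ h) (hb₂ h), ?_⟩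
        rw [← Finset.sum_add_distrib]
        exact Finset.sum_congr rfl fun h _ => by rw [Pi.add_apply, mul_add]
      · rintro a z ha ⟨b, hb, rfl⟩
        refine ⟨fun h => a * b h, fun h => R3'.mul_mem (hAR3' ha) (hb h), ?_⟩
        rw [Finset.mul_sum]
        exact Finset.sum_congr rfl fun h _ => by ring
      · intro g hg
        obtain ⟨hF, hb, hFb⟩ := hgen g hg
        have hFD' : ∀ h, ℓ ≤ lv' h → ∀ i, Ff g i ≤ D' h i := fun h hh i => by
          simp only [hD', if_pos hh]
          exact (hFe g hg i).trans (Nat.le_add_left _ _)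
        refine ⟨fun h => if hh : ℓ ≤ lv' h then (∏ i, y i ^ (D' h i - Ff g i)) * bf g h else 0,
          fun h => ?_, ?_⟩
        · by_cases hh : ℓ ≤ lv' h
          · simp only [dif_pos hh]
            exact R3'.mul_mem (hR₁R3' (R₁.prod_mem fun i _ => R₁.pow_mem (hyR₁ i) _))
              (hR₁R3' (hb h))
          · simp only [dif_neg hh]; exact R3'.zero_mem
        · conv_lhs => rw [← inv_mul_cancel_left₀ (hP0 (Ff g)) g, hFb, Finset.mul_sum]
          refine Finset.sum_congr rfl fun h hh => ?_
          have hh' : ℓ ≤ lv' h := (Finset.mem_filter.mp hh).2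
          simp only [dif_pos hh']
          rw [← adValue_prod_pow_div y hy0 _ _ (hFD' h hh')]
          have h1 := hP0 (Ff g)
          have h2 := hP0 (D' h)
          field_simp

/-- **Splitting off the high part.** Every element of `R₁[y_j / y^{D j} : all j]` is an element
of `R₁[y_j / y^{D j} : lv' j < ℓ]` plus an element of the ideal generated by the `y_h / y^{D h}`
of level `≥ ℓ`. -/
theorem adValue_split (D : Fin n → Fin n → ℕ) (ℓ : ℕ) {z : K}
    (hz : z ∈ Algebra.adjoin k ((R₁ : Set K) ∪
      Set.range (fun j => y j * (∏ i, y i ^ (D j i))⁻¹))) :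
    ∃ a₀ ∈ Algebra.adjoin k ((R₁ : Set K) ∪
        ((fun j => y j * (∏ i, y i ^ (D j i))⁻¹) '' {j | lv' j < ℓ})),
      ∃ b : Fin n → K, (∀ h, b h ∈ Algebra.adjoin k ((R₁ : Set K) ∪
        Set.range (fun j => y j * (∏ i, y i ^ (D j i))⁻¹))) ∧
        z = a₀ + ∑ h ∈ Finset.univ.filter (fun h => ℓ ≤ lv' h),
          (y h * (∏ i, y i ^ (D h i))⁻¹) * b h := by
  classical
  set R3 : Subalgebra k K := Algebra.adjoin k ((R₁ : Set K) ∪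
    Set.range (fun j => y j * (∏ i, y i ^ (D j i))⁻¹)) with hR3
  set A : Subalgebra k K := Algebra.adjoin k ((R₁ : Set K) ∪
    ((fun j => y j * (∏ i, y i ^ (D j i))⁻¹) '' {j | lv' j < ℓ})) with hA
  have hR₁R3 : R₁ ≤ R3 := fun z hz => Algebra.subset_adjoin (Or.inl hz)
  have hyDR3 : ∀ j, y j * (∏ i, y i ^ (D j i))⁻¹ ∈ R3 := fun j =>
    Algebra.subset_adjoin (Or.inr ⟨j, rfl⟩)
  have hAR3 : A ≤ R3 := by
    refine Algebra.adjoin_le ?_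
    rintro z (hz | ⟨j, -, rfl⟩)
    exacts [hR₁R3 hz, hyDR3 j]
  have hSR3 : ∀ b : Fin n → K, (∀ h, b h ∈ R3) → (∑ h ∈ Finset.univ.filter (fun h => ℓ ≤ lv' h),
      (y h * (∏ i, y i ^ (D h i))⁻¹) * b h) ∈ R3 := fun b hb =>
    R3.sum_mem fun h _ => R3.mul_mem (hyDR3 h) (hb h)
  induction hz using Algebra.adjoin_induction with
  | mem w hw =>
    rcases hw with hw | ⟨j, rfl⟩
    · exact ⟨w, Algebra.subset_adjoin (Or.inl hw), 0, fun _ => R3.zero_mem, by simp⟩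
    · by_cases hj : lv' j < ℓ
      · exact ⟨_, Algebra.subset_adjoin (Or.inr ⟨j, hj, rfl⟩), 0, fun _ => R3.zero_mem, by simp⟩
      · refine ⟨0, A.zero_mem, fun h => if h = j then 1 else 0, fun h => ?_, ?_⟩
        · dsimp only
          split_ifs
          exacts [R3.one_mem, R3.zero_mem]
        · simp only [mul_ite, mul_one, mul_zero, Finset.sum_ite_eq', Finset.mem_filter,
            Finset.mem_univ, true_and, if_pos (not_lt.mp hj), zero_add]
  | algebraMap c =>
    exact ⟨algebraMap k K c, A.algebraMap_mem c, 0, fun _ => R3.zero_mem, by simp⟩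
  | add w₁ w₂ _ _ ih₁ ih₂ =>
    obtain ⟨a₁, ha₁, b₁, hb₁, h₁⟩ := ih₁
    obtain ⟨a₂, ha₂, b₂, hb₂, h₂⟩ := ih₂
    refine ⟨a₁ + a₂, A.add_mem ha₁ ha₂, b₁ + b₂, fun h => R3.add_mem (hb₁ h) (hb₂ h), ?_⟩
    rw [h₁, h₂]
    simp only [Pi.add_apply, mul_add, Finset.sum_add_distrib]
    ring
  | mul w₁ w₂ _ _ ih₁ ih₂ =>
    obtain ⟨a₁, ha₁, b₁, hb₁, h₁⟩ := ih₁
    obtain ⟨a₂, ha₂, b₂, hb₂, h₂⟩ := ih₂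
    refine ⟨a₁ * a₂, A.mul_mem ha₁ ha₂, fun h => a₁ * b₂ h + b₁ h * w₂,
      fun h => R3.add_mem (R3.mul_mem (hAR3 ha₁) (hb₂ h))
        (R3.mul_mem (hb₁ h) (by rw [h₂]; exact R3.add_mem (hAR3 ha₂) (hSR3 b₂ hb₂))), ?_⟩
    have e1 : (∑ h ∈ Finset.univ.filter (fun h => ℓ ≤ lv' h),
        (y h * (∏ i, y i ^ (D h i))⁻¹) * (a₁ * b₂ h + b₁ h * w₂)) =
        a₁ * (∑ h ∈ Finset.univ.filter (fun h => ℓ ≤ lv' h),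
          (y h * (∏ i, y i ^ (D h i))⁻¹) * b₂ h) +
        (∑ h ∈ Finset.univ.filter (fun h => ℓ ≤ lv' h),
          (y h * (∏ i, y i ^ (D h i))⁻¹) * b₁ h) * w₂ := by
      rw [Finset.mul_sum, Finset.sum_mul, ← Finset.sum_add_distrib]
      exact Finset.sum_congr rfl fun h _ => by ring
    rw [e1, h₁, add_mul]
    nth_rewrite 1 [h₂]
    ring

end Recursion

/-- Registered anchor of this helper file: the value of a type-2 transformed parameter. -/
theorem adValue_anchor_recursion : ∀ (K : Type) [Field K] (O : ValuationSubring K) (n : ℕ) (y : Fin n → K) (D : Fin n → Fin n → ℕ) (j : Fin n), O.valuation (y j * (∏ i, y i ^ (D j i))⁻¹) = O.valuation (y j) * (∏ i, O.valuation (y i) ^ (D j i))⁻¹ := by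
  intro K _ O n y D j
  rw [map_mul, map_inv₀, valuation_prod_pow]

end Summit.ResolutionOfSingularities.ResolutionOfSingularities.Theorems.PfaffLine

end
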